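import Literature.AlgebraicGeometry.ModuliOfAbelianVarieties.SiegelFamilyHeckeCorrespondenceDegreeBound
import Literature.AlgebraicGeometry.ModuliOfAbelianVarieties.SiegelFamilyHeckeCorrespondenceSquareStrata
import HarnessLib

/-!
# `deg T(n) ≤ ∏_{p^e ∥ n} (deg T(p))^e` for every `n ≥ 1`, with equality IF AND ONLY IF `n` is squarefree (`g ≥ 1`): the
# number of Lagrangian subgroups of `X_{Z'}[n]` is bounded by the multiplicative function `n ↦ ∏_{p^e ∥ n} (∏_{i=1}^{g}(pⁱ + 1))^e`

Layer `Literature/AlgebraicGeometry/ModuliOfAbelianVarieties`, namespace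
`Literature.AlgebraicGeometry.ModuliOfAbelianVarieties.SiegelModuli`; lane `lit-hodgefound` (Track 2, Layer A4), seat
`lit-hodgefound-skel-4` (generation 56), row A4-206 of `run/shared/lean/pub/lit-hodgefound/SKELETON.md`.  Sequel of rows
A4-205 (`SiegelFamilyHeckeCorrespondenceDegreeBound`: `#Lag X_{Z'}[pn] ≤ ∏(pⁱ + 1) · #Lag X_{Z'}[n]`, strict at `n = p`) and
A4-200 (`SiegelFamilyHeckeCorrespondenceDegreeSquarefree`: `#Lag X_{Z'}[n] = ∏_{p ∣ n} ∏ (pⁱ + 1)` for squarefree `n`).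
The bound is written with Mathlib's `Nat.factorization` as the `Finsupp.prod`
`n.factorization.prod (q, e) ↦ (∏_{i=1}^{g}(qⁱ + 1))^e`.  Consumed BY NAME: A4-200 `natCard_isLagrangian_eq_one` ∕
`natCard_isLagrangian_eq_prod_primeFactors`, A4-205 `natCard_isLagrangian_mul_le` ∕ `natCard_isLagrangian_sq_lt_sq`, A4-155
`isLagrangian_iff_exists_isIsogeny_ker_eq`, A4-153 `isLagrangian_ker_of_eq_smul`, A4-196 `mul_div_mem_heckeSet`, A4-198
`natCard_isLagrangian_ge_ker_eq_natCard_isLagrangian` ∕ `finite_isLagrangian`, A4-204′ `exists_mem_heckeSet_factor`,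
Mathlib's `Nat.factorization_mul`, `Nat.Prime.factorization`, `Finsupp.prod_add_index'`, `Nat.factorization_eq_one_of_squarefree`,
`Nat.strong_induction_on`, `Nat.minFac_prime`.  THEOREMS ONLY (D-0026: no definition, no instance, no named fact; net debt `0`).

## Sources, verbatim

* A. N. Andrianov, V. G. Zhuravlev, *Modular Forms and Hecke Operators* (1995) [held text
  `book:andrianov2015-modular-forms-hecke-operators`], Ch. 3 §1.1 (1.8), Lemma 1.5 (p0098 L38 – p0099 L13) (the index
  `μ` is multiplicative on products of double cosets); §3 (3.20), Lemma 3.10 (p0137 L34–L48) («`T(m)T(m') = T(mm')` if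
  `(m, m') = 1`»); §4 (4.80) (p0177 L22–L27) («`T(p)² = Σ a_i T_i(p²)` … `a_0 > 0`»).
* G. van der Geer, *Siegel modular forms and their applications* (2008), §16 (p0253 L21).
* H. Lange, *Abelian Varieties over the Complex Numbers* (2023), §1.1.2 Prop. 1.1.13 (b) (p0022), §2.7.1 Cor. 2.7.3 (a) (p0149).

DEVIATION (said once).  The sources print the exact index calculus of the Hecke ring; this file only assembles the
kernel-count inequality of row A4-205 along the prime factorisation of `n` into the bound
`#Lag X_{Z'}[n] ≤ ∏_{p^e ∥ n} (∏_{i=1}^{g}(pⁱ + 1))^e`, attained for squarefree `n` (row A4-200) and missed at every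
non-squarefree `n` when `g ≥ 1` (§2, appended as row A4-206′: over each member of `T(m)(Z')` lie `#Lag X_{Z₁}[p²] <
(deg T(p))²` members of `T(p²m)(Z')`, rows A4-198 ∕ 205); the exact values for non-squarefree `n` are not claimed.

## What is proved

* **`natCard_isLagrangian_le_factorization_prod`** (`#Lag X_{Z'}[n] ≤ n.factorization.prod (q, e) ↦ (∏ (qⁱ + 1))^e` for every
  `n ≥ 1`), **`natCard_isLagrangian_eq_factorization_prod_of_squarefree`** (equality for squarefree `n`),
  `natCard_isLagrangian_lt_factorization_prod_sq` (`g ≥ 1`: strict for `n = p²`).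
* §2 (`g ≥ 1`, appended as row A4-206′): **`natCard_isLagrangian_sq_mul_lt`** (`#Lag X_{Z'}[p²m] < (∏ (pⁱ + 1))² · #Lag X_{Z'}[m]`
  for every `m ≥ 1`), **`natCard_isLagrangian_lt_factorization_prod_of_not_squarefree`**,
  **`natCard_isLagrangian_eq_factorization_prod_iff`** (`#Lag X_{Z'}[n] = ∏_{p^e ∥ n} (∏ (pⁱ + 1))^e ⟺ n` squarefree).

## References

* [AndrianovZhuravlev2015] A. N. Andrianov, V. G. Zhuravlev, *Modular Forms and Hecke Operators*, AMS (1995), Ch. 3 §1.1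
  (1.8), Lemma 1.5 (p0098–p0099), §3 (3.20), Lemma 3.10 (p0137), §4 (4.80) (p0177).
* [vanderGeer2008] G. van der Geer, in *The 1-2-3 of Modular Forms*, Springer (2008), §16 (p. 253 L21).
* [Lange2023AbelianVarietiesComplex] H. Lange, Springer (2023), §1.1.2 Prop. 1.1.13 (p0022), §2.7.1 Cor. 2.7.3 (a) (p0149).
-/

noncomputable section

open Matrix Module Function Set
open scoped Matrix

namespace Literature.AlgebraicGeometry.ModuliOfAbelianVarieties

namespace SiegelModuli

open Literature.NumberTheory.Automorphic (siegelUpperHalfSpace)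
open Literature.NumberTheory.ModularForms Literature.NumberTheory.ModularForms.SiegelUpperHalfSpace
open Literature.NumberTheory.ComplexMultiplication
open Literature.Geometry.Kaehler Literature.Geometry.Kaehler.ComplexTorus

variable {g : ℕ} (Z' : siegelUpperHalfSpace g)

/-- The bound `n ↦ ∏_{p^e ∥ n} D_p^e` is multiplicative (`Nat.factorization` is additive). [folklore] -/
private theorem factorization_prod_degreeBound_mul {a b : ℕ} (ha : a ≠ 0) (hb : b ≠ 0) :
    (a * b).factorization.prod (fun q e ↦ (∏ i ∈ Finset.range g, (q ^ (i + 1) + 1)) ^ e) =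
      a.factorization.prod (fun q e ↦ (∏ i ∈ Finset.range g, (q ^ (i + 1) + 1)) ^ e) *
        b.factorization.prod (fun q e ↦ (∏ i ∈ Finset.range g, (q ^ (i + 1) + 1)) ^ e) := by
  rw [Nat.factorization_mul ha hb, Finsupp.prod_add_index' (fun _ ↦ pow_zero _) (fun _ _ _ ↦ pow_add _ _ _)]

/-- At a prime the bound is `D_p = ∏_{i=1}^{g}(pⁱ + 1)`. [folklore] -/
private theorem factorization_prod_degreeBound_prime {p : ℕ} (hp : p.Prime) :
    p.factorization.prod (fun q e ↦ (∏ i ∈ Finset.range g, (q ^ (i + 1) + 1)) ^ e) =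
      ∏ i ∈ Finset.range g, (p ^ (i + 1) + 1) := by
  rw [hp.factorization, Finsupp.prod_single_index, pow_one]
  exact pow_zero _

/-- **`deg T(n) ≤ ∏_{p^e ∥ n} (deg T(p))^e` ON THE KERNELS, FOR EVERY `n ≥ 1`: `#Lag X_{Z'}[n] ≤ ∏_{p^e ∥ n} (∏_{i=1}^{g}(pⁱ + 1))^e`**
— strong induction on `n`, peeling off the least prime factor with row A4-205's `#Lag X_{Z'}[pn'] ≤ ∏(pⁱ + 1)·#Lag X_{Z'}[n']`.
[cite: AndrianovZhuravlev2015, Ch. 3 §1.1 (1.8), Lemma 1.5 (p0098 L38 – p0099 L13) and §3 (3.20), Lemma 3.10 (p0137)]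
[cite: vanderGeer2008, §16 (p. 253 L21)] [cite: Lange2023AbelianVarietiesComplex, §1.1.2 Prop. 1.1.13 (b) (p0022) and §2.7.1 Cor. 2.7.3 (a) (p0149)] -/
theorem natCard_isLagrangian_le_factorization_prod :
    ∀ {n : ℕ}, n ≠ 0 →
      Nat.card {K : AddSubgroup (ComplexTorus (prinPeriod Z' : (Fin g ⊕ Fin g → ℝ) ≃L[ℝ] (Fin g → ℂ))) //
          K ≤ (mapMatrixHom (prinPeriod Z') (prinPeriod Z') ((n : ℤ) • (1 : Matrix (Fin g ⊕ Fin g) (Fin g ⊕ Fin g) ℤ))).ker ∧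
          (∀ s ∈ K, ∀ t ∈ K,
            weilPairing (prinPeriod Z' : (Fin g ⊕ Fin g → ℝ) ≃L[ℝ] (Fin g → ℂ)) ((n : ℝ) • prinForm Z') s t = 1) ∧
          Nat.card K ^ 2 = Nat.card (mapMatrixHom (prinPeriod Z') (prinPeriod Z')
            ((n : ℤ) • (1 : Matrix (Fin g ⊕ Fin g) (Fin g ⊕ Fin g) ℤ))).ker} ≤
        n.factorization.prod (fun q e ↦ (∏ i ∈ Finset.range g, (q ^ (i + 1) + 1)) ^ e) := by
  intro n
  induction n using Nat.strong_induction_on with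
  | _ n ih =>
    intro hn
    rcases eq_or_ne n 1 with rfl | hn1
    · rw [Nat.factorization_one, Finsupp.prod_zero_index, natCard_isLagrangian_eq_one Z']
    · have hp : n.minFac.Prime := Nat.minFac_prime hn1
      haveI : Fact n.minFac.Prime := ⟨hp⟩
      set n' := n / n.minFac with hn'
      have hn'n : n.minFac * n' = n := Nat.mul_div_cancel' (Nat.minFac_dvd n)
      have hn'0 : n' ≠ 0 := fun h ↦ hn (by rw [← hn'n, h, mul_zero])
      have hlt : n' < n := Nat.div_lt_self (Nat.pos_of_ne_zero hn) hp.one_lt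
      have h := natCard_isLagrangian_mul_le Z' (p := n.minFac) hn'0
      rw [← hn'n, factorization_prod_degreeBound_mul hp.ne_zero hn'0, factorization_prod_degreeBound_prime hp]
      exact h.trans (Nat.mul_le_mul_left _ (ih n' hlt hn'0))

/-- **EQUALITY FOR SQUAREFREE `n`**: `#Lag X_{Z'}[n] = ∏_{p ∣ n} ∏_{i=1}^{g}(pⁱ + 1) = ∏_{p^e ∥ n} (∏ (pⁱ + 1))^e` (row A4-200;
all exponents `e = 1`). [cite: AndrianovZhuravlev2015, Ch. 3 §3 (3.20), Lemma 3.10 (p0137 L34–L48)] [cite: vanderGeer2008, §16 (p. 253 L21)] -/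
theorem natCard_isLagrangian_eq_factorization_prod_of_squarefree {n : ℕ} (hn : Squarefree n) :
    Nat.card {K : AddSubgroup (ComplexTorus (prinPeriod Z' : (Fin g ⊕ Fin g → ℝ) ≃L[ℝ] (Fin g → ℂ))) //
        K ≤ (mapMatrixHom (prinPeriod Z') (prinPeriod Z') ((n : ℤ) • (1 : Matrix (Fin g ⊕ Fin g) (Fin g ⊕ Fin g) ℤ))).ker ∧
        (∀ s ∈ K, ∀ t ∈ K,
          weilPairing (prinPeriod Z' : (Fin g ⊕ Fin g → ℝ) ≃L[ℝ] (Fin g → ℂ)) ((n : ℝ) • prinForm Z') s t = 1) ∧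
        Nat.card K ^ 2 = Nat.card (mapMatrixHom (prinPeriod Z') (prinPeriod Z')
          ((n : ℤ) • (1 : Matrix (Fin g ⊕ Fin g) (Fin g ⊕ Fin g) ℤ))).ker} =
      n.factorization.prod (fun q e ↦ (∏ i ∈ Finset.range g, (q ^ (i + 1) + 1)) ^ e) := by
  rw [natCard_isLagrangian_eq_prod_primeFactors Z' hn, Finsupp.prod, Nat.support_factorization]
  refine Finset.prod_congr rfl fun q hq ↦ ?_
  rw [Nat.factorization_eq_one_of_squarefree hn (Nat.prime_of_mem_primeFactors hq) (Nat.dvd_of_mem_primeFactors hq),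
    pow_one]

/-- … and the bound is MISSED at `n = p²` (`g ≥ 1`): `#Lag X_{Z'}[p²] < (∏ (pⁱ + 1))² = ∏_{q^e ∥ p²} (∏ (qⁱ + 1))^e`
(row A4-205). [cite: AndrianovZhuravlev2015, Ch. 3 §4 (4.80) (p0177 L22–L27)] [cite: vanderGeer2008, §16 (p. 253 L21)] -/
theorem natCard_isLagrangian_lt_factorization_prod_sq (hg : 1 ≤ g) {p : ℕ} [hp : Fact p.Prime] :
    Nat.card {K : AddSubgroup (ComplexTorus (prinPeriod Z' : (Fin g ⊕ Fin g → ℝ) ≃L[ℝ] (Fin g → ℂ))) //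
        K ≤ (mapMatrixHom (prinPeriod Z') (prinPeriod Z')
          (((p ^ 2 : ℕ) : ℤ) • (1 : Matrix (Fin g ⊕ Fin g) (Fin g ⊕ Fin g) ℤ))).ker ∧
        (∀ s ∈ K, ∀ t ∈ K,
          weilPairing (prinPeriod Z' : (Fin g ⊕ Fin g → ℝ) ≃L[ℝ] (Fin g → ℂ)) (((p ^ 2 : ℕ) : ℝ) • prinForm Z') s t = 1) ∧
        Nat.card K ^ 2 = Nat.card (mapMatrixHom (prinPeriod Z') (prinPeriod Z')
          (((p ^ 2 : ℕ) : ℤ) • (1 : Matrix (Fin g ⊕ Fin g) (Fin g ⊕ Fin g) ℤ))).ker} <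
      (p ^ 2).factorization.prod (fun q e ↦ (∏ i ∈ Finset.range g, (q ^ (i + 1) + 1)) ^ e) := by
  rw [Nat.factorization_pow, hp.out.factorization, Finsupp.smul_single, Finsupp.prod_single_index, smul_eq_mul, mul_one]
  · exact natCard_isLagrangian_sq_lt_sq Z' hg
  · exact pow_zero _


/-! ## §2 `g ≥ 1`: the bound is attained iff `n` is squarefree -/

section Iff

variable {p : ℕ} [hp : Fact p.Prime] {m n : ℕ}

/-- **`#Lag X_{Z'}[p²m] < (∏_{i=1}^{g}(pⁱ + 1))² · #Lag X_{Z'}[m]`** for `g ≥ 1`, `m ≥ 1`: every Lagrangian of `X_{Z'}[p²m]`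
contains a Lagrangian `K₁ = Ker B` of `X_{Z'}[m]` (row A4-204′), over each such `(Z₁, B) ∈ T(m)(Z')` lie exactly
`#Lag X_{Z₁}[p²]` of them (row A4-198), each `< (deg T(p))²` (row A4-205), and `T(m)(Z')` is non-empty (row A4-196's diagonal
member). [cite: AndrianovZhuravlev2015, Ch. 3 §1.1 (1.8), Lemma 1.5 (p0098 L38 – p0099 L13) and §4 (4.80) (p0177 L22–L27)]
[cite: vanderGeer2008, §16 (p. 253 L21)] [cite: Lange2023AbelianVarietiesComplex, §1.1.2 Prop. 1.1.13 (b) (p0022) and §2.7.1 Cor. 2.7.3 (a) (p0149)] -/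
theorem natCard_isLagrangian_sq_mul_lt (hg : 1 ≤ g) (hm : m ≠ 0) :
    Nat.card {K : AddSubgroup (ComplexTorus (prinPeriod Z' : (Fin g ⊕ Fin g → ℝ) ≃L[ℝ] (Fin g → ℂ))) //
        K ≤ (mapMatrixHom (prinPeriod Z') (prinPeriod Z')
          (((p ^ 2 * m : ℕ) : ℤ) • (1 : Matrix (Fin g ⊕ Fin g) (Fin g ⊕ Fin g) ℤ))).ker ∧
        (∀ s ∈ K, ∀ t ∈ K,
          weilPairing (prinPeriod Z' : (Fin g ⊕ Fin g → ℝ) ≃L[ℝ] (Fin g → ℂ)) (((p ^ 2 * m : ℕ) : ℝ) • prinForm Z') s t = 1) ∧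
        Nat.card K ^ 2 = Nat.card (mapMatrixHom (prinPeriod Z') (prinPeriod Z')
          (((p ^ 2 * m : ℕ) : ℤ) • (1 : Matrix (Fin g ⊕ Fin g) (Fin g ⊕ Fin g) ℤ))).ker} <
      (∏ i ∈ Finset.range g, (p ^ (i + 1) + 1)) ^ 2 *
        Nat.card {K₁ : AddSubgroup (ComplexTorus (prinPeriod Z' : (Fin g ⊕ Fin g → ℝ) ≃L[ℝ] (Fin g → ℂ))) //
          K₁ ≤ (mapMatrixHom (prinPeriod Z') (prinPeriod Z') ((m : ℤ) • (1 : Matrix (Fin g ⊕ Fin g) (Fin g ⊕ Fin g) ℤ))).ker ∧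
          (∀ s ∈ K₁, ∀ t ∈ K₁,
            weilPairing (prinPeriod Z' : (Fin g ⊕ Fin g → ℝ) ≃L[ℝ] (Fin g → ℂ)) ((m : ℝ) • prinForm Z') s t = 1) ∧
          Nat.card K₁ ^ 2 = Nat.card (mapMatrixHom (prinPeriod Z') (prinPeriod Z')
            ((m : ℤ) • (1 : Matrix (Fin g ⊕ Fin g) (Fin g ⊕ Fin g) ℤ))).ker} := by
  classical
  have hp2 : p ^ 2 ≠ 0 := pow_ne_zero 2 hp.out.ne_zero
  haveI := finite_isLagrangian Z' hm
  haveI := finite_isLagrangian Z' (mul_ne_zero hp2 hm)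
  letI := Fintype.ofFinite {K₁ : AddSubgroup (ComplexTorus (prinPeriod Z' : (Fin g ⊕ Fin g → ℝ) ≃L[ℝ] (Fin g → ℂ))) //
    K₁ ≤ (mapMatrixHom (prinPeriod Z') (prinPeriod Z') ((m : ℤ) • (1 : Matrix (Fin g ⊕ Fin g) (Fin g ⊕ Fin g) ℤ))).ker ∧
    (∀ s ∈ K₁, ∀ t ∈ K₁,
      weilPairing (prinPeriod Z' : (Fin g ⊕ Fin g → ℝ) ≃L[ℝ] (Fin g → ℂ)) ((m : ℝ) • prinForm Z') s t = 1) ∧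
    Nat.card K₁ ^ 2 = Nat.card (mapMatrixHom (prinPeriod Z') (prinPeriod Z')
      ((m : ℤ) • (1 : Matrix (Fin g ⊕ Fin g) (Fin g ⊕ Fin g) ℤ))).ker}
  -- `T(m)(Z')` is non-empty: the diagonal member of row A4-196 (`δ ≡ 1`)
  haveI : Nonempty {K₁ : AddSubgroup (ComplexTorus (prinPeriod Z' : (Fin g ⊕ Fin g → ℝ) ≃L[ℝ] (Fin g → ℂ))) //
      K₁ ≤ (mapMatrixHom (prinPeriod Z') (prinPeriod Z') ((m : ℤ) • (1 : Matrix (Fin g ⊕ Fin g) (Fin g ⊕ Fin g) ℤ))).ker ∧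
      (∀ s ∈ K₁, ∀ t ∈ K₁,
        weilPairing (prinPeriod Z' : (Fin g ⊕ Fin g → ℝ) ≃L[ℝ] (Fin g → ℂ)) ((m : ℝ) • prinForm Z') s t = 1) ∧
      Nat.card K₁ ^ 2 = Nat.card (mapMatrixHom (prinPeriod Z') (prinPeriod Z')
        ((m : ℤ) • (1 : Matrix (Fin g ⊕ Fin g) (Fin g ⊕ Fin g) ℤ))).ker} := by
    obtain ⟨B, hB, hqB⟩ := mul_div_mem_heckeSet (δ := fun _ : Fin g ↦ 1) (fun _ ↦ one_pos) (Nat.pos_of_ne_zero hm)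
      (fun _ ↦ one_dvd m) Z'
    exact ⟨⟨_, isLagrangian_ker_of_eq_smul hm hB hqB⟩⟩
  -- every Lagrangian of `X[p²m]` contains a Lagrangian of `X[m]`
  have key : ∀ K : {K : AddSubgroup (ComplexTorus (prinPeriod Z' : (Fin g ⊕ Fin g → ℝ) ≃L[ℝ] (Fin g → ℂ))) //
      K ≤ (mapMatrixHom (prinPeriod Z') (prinPeriod Z')
        (((p ^ 2 * m : ℕ) : ℤ) • (1 : Matrix (Fin g ⊕ Fin g) (Fin g ⊕ Fin g) ℤ))).ker ∧
      (∀ s ∈ K, ∀ t ∈ K,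
        weilPairing (prinPeriod Z' : (Fin g ⊕ Fin g → ℝ) ≃L[ℝ] (Fin g → ℂ)) (((p ^ 2 * m : ℕ) : ℝ) • prinForm Z') s t = 1) ∧
      Nat.card K ^ 2 = Nat.card (mapMatrixHom (prinPeriod Z') (prinPeriod Z')
        (((p ^ 2 * m : ℕ) : ℤ) • (1 : Matrix (Fin g ⊕ Fin g) (Fin g ⊕ Fin g) ℤ))).ker},
      ∃ K₁ : {K₁ : AddSubgroup (ComplexTorus (prinPeriod Z' : (Fin g ⊕ Fin g → ℝ) ≃L[ℝ] (Fin g → ℂ))) //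
        K₁ ≤ (mapMatrixHom (prinPeriod Z') (prinPeriod Z') ((m : ℤ) • (1 : Matrix (Fin g ⊕ Fin g) (Fin g ⊕ Fin g) ℤ))).ker ∧
        (∀ s ∈ K₁, ∀ t ∈ K₁,
          weilPairing (prinPeriod Z' : (Fin g ⊕ Fin g → ℝ) ≃L[ℝ] (Fin g → ℂ)) ((m : ℝ) • prinForm Z') s t = 1) ∧
        Nat.card K₁ ^ 2 = Nat.card (mapMatrixHom (prinPeriod Z') (prinPeriod Z')
          ((m : ℤ) • (1 : Matrix (Fin g ⊕ Fin g) (Fin g ⊕ Fin g) ℤ))).ker}, K₁.1 ≤ K.1 := fun K ↦ by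
    obtain ⟨Z, A, hA, hker, hq⟩ := (isLagrangian_iff_exists_isIsogeny_ker_eq (mul_ne_zero hp2 hm)).1 K.2
    obtain ⟨Z₁, B, C, hB, hqB, -, -, hCB⟩ := exists_mem_heckeSet_factor m hp2 hm hA hq
    refine ⟨⟨(mapMatrixHom (prinPeriod Z') (prinPeriod Z₁) B).ker, isLagrangian_ker_of_eq_smul hm hB hqB⟩, ?_⟩
    change (mapMatrixHom (prinPeriod Z') (prinPeriod Z₁) B).ker ≤ K.1
    rw [← hker, ← hCB]
    exact ker_le_ker_mul _ _ _ C B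
  choose f hf using key
  -- the fibres: over `K₁ = Ker B`, `#Lag X_{Z₁}[p²] < (deg T(p))²`
  have hfib : ∀ K₁ : {K₁ : AddSubgroup (ComplexTorus (prinPeriod Z' : (Fin g ⊕ Fin g → ℝ) ≃L[ℝ] (Fin g → ℂ))) //
      K₁ ≤ (mapMatrixHom (prinPeriod Z') (prinPeriod Z') ((m : ℤ) • (1 : Matrix (Fin g ⊕ Fin g) (Fin g ⊕ Fin g) ℤ))).ker ∧
      (∀ s ∈ K₁, ∀ t ∈ K₁,
        weilPairing (prinPeriod Z' : (Fin g ⊕ Fin g → ℝ) ≃L[ℝ] (Fin g → ℂ)) ((m : ℝ) • prinForm Z') s t = 1) ∧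
      Nat.card K₁ ^ 2 = Nat.card (mapMatrixHom (prinPeriod Z') (prinPeriod Z')
        ((m : ℤ) • (1 : Matrix (Fin g ⊕ Fin g) (Fin g ⊕ Fin g) ℤ))).ker},
      Nat.card {K : {K : AddSubgroup (ComplexTorus (prinPeriod Z' : (Fin g ⊕ Fin g → ℝ) ≃L[ℝ] (Fin g → ℂ))) //
          K ≤ (mapMatrixHom (prinPeriod Z') (prinPeriod Z')
            (((p ^ 2 * m : ℕ) : ℤ) • (1 : Matrix (Fin g ⊕ Fin g) (Fin g ⊕ Fin g) ℤ))).ker ∧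
          (∀ s ∈ K, ∀ t ∈ K,
            weilPairing (prinPeriod Z' : (Fin g ⊕ Fin g → ℝ) ≃L[ℝ] (Fin g → ℂ)) (((p ^ 2 * m : ℕ) : ℝ) • prinForm Z') s t = 1) ∧
          Nat.card K ^ 2 = Nat.card (mapMatrixHom (prinPeriod Z') (prinPeriod Z')
            (((p ^ 2 * m : ℕ) : ℤ) • (1 : Matrix (Fin g ⊕ Fin g) (Fin g ⊕ Fin g) ℤ))).ker} // K₁.1 ≤ K.1} <
        (∏ i ∈ Finset.range g, (p ^ (i + 1) + 1)) ^ 2 := fun K₁ ↦ by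
    obtain ⟨Z₁, B, hB, hker, hqB⟩ := (isLagrangian_iff_exists_isIsogeny_ker_eq hm).1 K₁.2
    have h := natCard_isLagrangian_ge_ker_eq_natCard_isLagrangian hp2 hm hB hqB
    rw [hker] at h
    have h' : Nat.card {K : {K : AddSubgroup (ComplexTorus (prinPeriod Z' : (Fin g ⊕ Fin g → ℝ) ≃L[ℝ] (Fin g → ℂ))) //
          K ≤ (mapMatrixHom (prinPeriod Z') (prinPeriod Z')
            (((p ^ 2 * m : ℕ) : ℤ) • (1 : Matrix (Fin g ⊕ Fin g) (Fin g ⊕ Fin g) ℤ))).ker ∧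
          (∀ s ∈ K, ∀ t ∈ K,
            weilPairing (prinPeriod Z' : (Fin g ⊕ Fin g → ℝ) ≃L[ℝ] (Fin g → ℂ)) (((p ^ 2 * m : ℕ) : ℝ) • prinForm Z') s t = 1) ∧
          Nat.card K ^ 2 = Nat.card (mapMatrixHom (prinPeriod Z') (prinPeriod Z')
            (((p ^ 2 * m : ℕ) : ℤ) • (1 : Matrix (Fin g ⊕ Fin g) (Fin g ⊕ Fin g) ℤ))).ker} // K₁.1 ≤ K.1} =
        Nat.card {K₂ : AddSubgroup (ComplexTorus (prinPeriod Z₁ : (Fin g ⊕ Fin g → ℝ) ≃L[ℝ] (Fin g → ℂ))) //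
          K₂ ≤ (mapMatrixHom (prinPeriod Z₁) (prinPeriod Z₁)
            (((p ^ 2 : ℕ) : ℤ) • (1 : Matrix (Fin g ⊕ Fin g) (Fin g ⊕ Fin g) ℤ))).ker ∧
          (∀ s ∈ K₂, ∀ t ∈ K₂,
            weilPairing (prinPeriod Z₁ : (Fin g ⊕ Fin g → ℝ) ≃L[ℝ] (Fin g → ℂ)) (((p ^ 2 : ℕ) : ℝ) • prinForm Z₁) s t = 1) ∧
          Nat.card K₂ ^ 2 = Nat.card (mapMatrixHom (prinPeriod Z₁) (prinPeriod Z₁)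
            (((p ^ 2 : ℕ) : ℤ) • (1 : Matrix (Fin g ⊕ Fin g) (Fin g ⊕ Fin g) ℤ))).ker} := by
      rw [← h]
      exact Nat.card_congr
        { toFun := fun K ↦ ⟨K.1.1, K.1.2, K.2⟩
          invFun := fun K ↦ ⟨⟨K.1, K.2.1⟩, K.2.2⟩
          left_inv := fun _ ↦ rfl
          right_inv := fun _ ↦ rfl }
    rw [h']
    exact natCard_isLagrangian_sq_lt_sq Z₁ hg
  calc Nat.card _ ≤ Nat.card (Σ K₁ : {K₁ : AddSubgroup (ComplexTorus (prinPeriod Z' : (Fin g ⊕ Fin g → ℝ) ≃L[ℝ] (Fin g → ℂ))) //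
          K₁ ≤ (mapMatrixHom (prinPeriod Z') (prinPeriod Z') ((m : ℤ) • (1 : Matrix (Fin g ⊕ Fin g) (Fin g ⊕ Fin g) ℤ))).ker ∧
          (∀ s ∈ K₁, ∀ t ∈ K₁,
            weilPairing (prinPeriod Z' : (Fin g ⊕ Fin g → ℝ) ≃L[ℝ] (Fin g → ℂ)) ((m : ℝ) • prinForm Z') s t = 1) ∧
          Nat.card K₁ ^ 2 = Nat.card (mapMatrixHom (prinPeriod Z') (prinPeriod Z')
            ((m : ℤ) • (1 : Matrix (Fin g ⊕ Fin g) (Fin g ⊕ Fin g) ℤ))).ker},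
        {K : {K : AddSubgroup (ComplexTorus (prinPeriod Z' : (Fin g ⊕ Fin g → ℝ) ≃L[ℝ] (Fin g → ℂ))) //
          K ≤ (mapMatrixHom (prinPeriod Z') (prinPeriod Z')
            (((p ^ 2 * m : ℕ) : ℤ) • (1 : Matrix (Fin g ⊕ Fin g) (Fin g ⊕ Fin g) ℤ))).ker ∧
          (∀ s ∈ K, ∀ t ∈ K,
            weilPairing (prinPeriod Z' : (Fin g ⊕ Fin g → ℝ) ≃L[ℝ] (Fin g → ℂ)) (((p ^ 2 * m : ℕ) : ℝ) • prinForm Z') s t = 1) ∧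
          Nat.card K ^ 2 = Nat.card (mapMatrixHom (prinPeriod Z') (prinPeriod Z')
            (((p ^ 2 * m : ℕ) : ℤ) • (1 : Matrix (Fin g ⊕ Fin g) (Fin g ⊕ Fin g) ℤ))).ker} // K₁.1 ≤ K.1}) :=
        Nat.card_le_card_of_injective (fun K ↦ ⟨f K, ⟨K, hf K⟩⟩) fun K K' h ↦ congrArg (fun x ↦ x.2.1) h
    _ < (∏ i ∈ Finset.range g, (p ^ (i + 1) + 1)) ^ 2 * Nat.card _ := by
      rw [Nat.card_sigma]
      refine (Finset.sum_lt_sum_of_nonempty Finset.univ_nonempty fun K₁ _ ↦ hfib K₁).trans_eq ?_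
      rw [Finset.sum_const, Finset.card_univ, smul_eq_mul, ← Nat.card_eq_fintype_card, mul_comm]

/-- **`g ≥ 1`, `n` NOT SQUAREFREE ⟹ `#Lag X_{Z'}[n] < ∏_{p^e ∥ n} (∏ (pⁱ + 1))^e`**: `n = p²m`, and
`#Lag X_{Z'}[p²m] < (∏ (pⁱ + 1))² · #Lag X_{Z'}[m] ≤ (∏ (pⁱ + 1))² · ∏_{q^e ∥ m} (∏ (qⁱ + 1))^e = ∏_{q^e ∥ n} (∏ (qⁱ + 1))^e`.
[cite: AndrianovZhuravlev2015, Ch. 3 §4 (4.80) (p0177 L22–L27) and §3 (3.20), Lemma 3.10 (p0137)] [cite: vanderGeer2008, §16 (p. 253 L21)] -/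
theorem natCard_isLagrangian_lt_factorization_prod_of_not_squarefree (hg : 1 ≤ g) (hn : n ≠ 0) (hsq : ¬ Squarefree n) :
    Nat.card {K : AddSubgroup (ComplexTorus (prinPeriod Z' : (Fin g ⊕ Fin g → ℝ) ≃L[ℝ] (Fin g → ℂ))) //
        K ≤ (mapMatrixHom (prinPeriod Z') (prinPeriod Z') ((n : ℤ) • (1 : Matrix (Fin g ⊕ Fin g) (Fin g ⊕ Fin g) ℤ))).ker ∧
        (∀ s ∈ K, ∀ t ∈ K,
          weilPairing (prinPeriod Z' : (Fin g ⊕ Fin g → ℝ) ≃L[ℝ] (Fin g → ℂ)) ((n : ℝ) • prinForm Z') s t = 1) ∧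
        Nat.card K ^ 2 = Nat.card (mapMatrixHom (prinPeriod Z') (prinPeriod Z')
          ((n : ℤ) • (1 : Matrix (Fin g ⊕ Fin g) (Fin g ⊕ Fin g) ℤ))).ker} <
      n.factorization.prod (fun q e ↦ (∏ i ∈ Finset.range g, (q ^ (i + 1) + 1)) ^ e) := by
  rw [Nat.squarefree_iff_prime_squarefree] at hsq
  simp only [not_forall, not_not] at hsq
  obtain ⟨p, hp, hpn⟩ := hsq
  haveI : Fact p.Prime := ⟨hp⟩
  obtain ⟨m, hm⟩ := hpn
  have hm0 : m ≠ 0 := fun h ↦ hn (by rw [hm, h, mul_zero])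
  have hn' : p ^ 2 * m = n := by rw [hm, sq]
  rw [← hn']
  calc Nat.card _ < (∏ i ∈ Finset.range g, (p ^ (i + 1) + 1)) ^ 2 * Nat.card _ := natCard_isLagrangian_sq_mul_lt Z' hg hm0
    _ ≤ (∏ i ∈ Finset.range g, (p ^ (i + 1) + 1)) ^ 2 *
        m.factorization.prod (fun q e ↦ (∏ i ∈ Finset.range g, (q ^ (i + 1) + 1)) ^ e) :=
      Nat.mul_le_mul_left _ (natCard_isLagrangian_le_factorization_prod Z' hm0)
    _ = (p ^ 2 * m).factorization.prod (fun q e ↦ (∏ i ∈ Finset.range g, (q ^ (i + 1) + 1)) ^ e) := by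
      rw [factorization_prod_degreeBound_mul (pow_ne_zero 2 hp.ne_zero) hm0, Nat.factorization_pow, hp.factorization,
        Finsupp.smul_single, Finsupp.prod_single_index, smul_eq_mul, mul_one]
      exact pow_zero _

/-- **THE BOUND IS ATTAINED IFF `n` IS SQUAREFREE** (`g ≥ 1`, `n ≥ 1`):
`#Lag X_{Z'}[n] = ∏_{p^e ∥ n} (∏_{i=1}^{g}(pⁱ + 1))^e ⟺ n` squarefree — the kernel-count form of «`T(m)T(m') = T(mm')` iff
`(m, m') = 1`» along the prime factorisation. [cite: AndrianovZhuravlev2015, Ch. 3 §3 (3.20), Lemma 3.10 (p0137 L34–L48) and §4 (4.80) (p0177 L22–L27)]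
[cite: vanderGeer2008, §16 (p. 253 L21)] [cite: Lange2023AbelianVarietiesComplex, §2.7.1 Cor. 2.7.3 (a) (p0149)] -/
theorem natCard_isLagrangian_eq_factorization_prod_iff (hg : 1 ≤ g) (hn : n ≠ 0) :
    Nat.card {K : AddSubgroup (ComplexTorus (prinPeriod Z' : (Fin g ⊕ Fin g → ℝ) ≃L[ℝ] (Fin g → ℂ))) //
        K ≤ (mapMatrixHom (prinPeriod Z') (prinPeriod Z') ((n : ℤ) • (1 : Matrix (Fin g ⊕ Fin g) (Fin g ⊕ Fin g) ℤ))).ker ∧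
        (∀ s ∈ K, ∀ t ∈ K,
          weilPairing (prinPeriod Z' : (Fin g ⊕ Fin g → ℝ) ≃L[ℝ] (Fin g → ℂ)) ((n : ℝ) • prinForm Z') s t = 1) ∧
        Nat.card K ^ 2 = Nat.card (mapMatrixHom (prinPeriod Z') (prinPeriod Z')
          ((n : ℤ) • (1 : Matrix (Fin g ⊕ Fin g) (Fin g ⊕ Fin g) ℤ))).ker} =
      n.factorization.prod (fun q e ↦ (∏ i ∈ Finset.range g, (q ^ (i + 1) + 1)) ^ e) ↔ Squarefree n :=
  ⟨fun h ↦ by_contra fun hsq ↦ (natCard_isLagrangian_lt_factorization_prod_of_not_squarefree Z' hg hn hsq).ne h,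
    fun h ↦ natCard_isLagrangian_eq_factorization_prod_of_squarefree Z' h⟩

end Iff

end SiegelModuli

end Literature.AlgebraicGeometry.ModuliOfAbelianVarieties

end
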